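import Literature.Analysis.UnboundedOperators.RankOneMildRenewal
import HarnessLib

/-!
# Rank-one feedback around a C₀-semigroup, II: scalar decay modulo a mode `e^{at}` gives vector decay modulo `e^{at}·R(a)f`

Topic `Literature/Analysis/UnboundedOperators`; continuation of `RankOneMildRenewal.lean` (same setting, same source), with the growth rate of the
distinguished mode an ARBITRARY real `a` with `a + μ > 0` instead of `1`. Everything PROVED.

SETTING. `S` a C₀-semigroup on a complex Banach space `X` with `‖S(t)‖ ≤ e^{−μt}` (`μ > 0`), `ℓ : X →L[ℂ] ℂ`, `f ∈ X`, and a continuous MILD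
SOLUTION of the rank-one feedback problem `u′ = Au + ℓ(u)f`: `u(t) = S(t)u₀ + ∫₀ᵗ S(t − s)(ℓ(u(s))·f) ds` (`t ≥ 0`; Engel–Nagel III Cor. 1.7 (IE)).

* `norm_integral_Ioi_resolvent_le_rate` — the tail of the resolvent integral at `a`: `‖∫_{(t,∞)} e^{−aσ}S(σ)f dσ‖ ≤ ‖f‖e^{−(a+μ)t}/(a + μ)`;
* `integral_exp_smul_app_eq_rate` — `∫₀ᵗ e^{as}·S(t − s)f ds = e^{at}·(R(a)f − ∫_{(t,∞)} e^{−aσ}S(σ)f dσ)`, `R(a)f = ∫₀^∞ e^{−aσ}S(σ)f dσ`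
  (`C0Semigroup.laplaceResolventFun S a f`, Engel–Nagel II (1.13));
* `norm_mild_sub_mode_le_rate` — **SCALAR DECAY ⇒ VECTOR DECAY at rate `a`**: if `‖ℓ(u(s)) − c₁e^{as}‖ ≤ M e^{−β′s}` on `s ≥ 0` with `β′ < μ`,
  then `‖u(t) − c₁e^{at}·R(a)f‖ ≤ (‖u₀‖ + M‖f‖/(μ − β′) + ‖c₁‖‖f‖/(a + μ))·e^{−β′t}` for all `t ≥ 0` — the growing mode's DIRECTION is the
  resolvent vector `R(a)f`. (`a = 1` is `RankOneMildRenewal.norm_mild_sub_mode_le`.)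

USE (cell ns-blowup, Z3-SR-SPEC even half, «linearly stable modulo translation»; the even Evans function's zero of record sits at `σ = 1/2`): with the
scalar renewal theorem at a simple real zero `a` every mild solution of the linearised even sheet flow is `c(u₀)e^{at}·R(a)f + O(e^{−β′t})`.
NOT here: existence/uniqueness of mild solutions, any model.

## References
* K.-J. Engel, R. Nagel, *One-Parameter Semigroups for Linear Evolution Equations*, Springer GTM 194 (2000), Ch. III Cor. 1.7, Ch. II Thm. 1.10 (1.13)–(1.14). [EngelNagel2000]
-/

noncomputable section

open _root_.MeasureTheory _root_.Set _root_.Filter _root_.Real _root_.Complex intervalIntegral NNReal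
open scoped _root_.Topology
open Literature.Analysis.Convolution

namespace Literature.Analysis.UnboundedOperators

namespace C0Semigroup

variable {X : Type*} [NormedAddCommGroup X] [NormedSpace ℂ X]
variable (S : C0Semigroup ℂ X) (ℓ : X →L[ℂ] ℂ) (f u₀ : X)

section DecayRate

variable {S ℓ f u₀}
variable {u : ℝ → X}

/-- `‖e^{−aσ}‖·‖S(σ)f‖ ≤ ‖f‖e^{−(a+μ)σ}` for real `a` and `σ ≥ 0`. [cite: EngelNagel2000, Ch. II Thm. 1.10 (1.14)] -/
theorem norm_exp_smul_app_le_rate {μ : ℝ} (hS : ∀ t : ℝ≥0, ‖S.app t‖ ≤ Real.exp (-μ * t)) (a : ℝ) {σ : ℝ} (hσ : 0 ≤ σ) :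
    ‖cexp (-((a : ℂ) * σ)) • S.app (Real.toNNReal σ) f‖ ≤ ‖f‖ * Real.exp (-(a + μ) * σ) := by
  rw [norm_smul, Complex.norm_exp]
  have hre : (-((a : ℂ) * σ)).re = -(a * σ) := by simp
  rw [hre]
  calc Real.exp (-(a * σ)) * ‖S.app (Real.toNNReal σ) f‖ ≤ Real.exp (-(a * σ)) * (Real.exp (-μ * σ) * ‖f‖) :=
        mul_le_mul_of_nonneg_left (S.norm_app_toNNReal_le hS f hσ) (Real.exp_pos _).le
    _ = ‖f‖ * Real.exp (-(a + μ) * σ) := by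
        rw [show -(a + μ) * σ = -(a * σ) + -μ * σ by ring, Real.exp_add]; ring

/-- The tail of the resolvent integral at `a`: `‖∫_{(t,∞)} e^{−aσ}S(σ)f dσ‖ ≤ ‖f‖e^{−(a+μ)t}/(a+μ)` (`t ≥ 0`, `a + μ > 0`).
[cite: EngelNagel2000, Ch. II Thm. 1.10 (1.14)] -/
theorem norm_integral_Ioi_resolvent_le_rate {μ a : ℝ} (hS : ∀ t : ℝ≥0, ‖S.app t‖ ≤ Real.exp (-μ * t)) (hμ : 0 < a + μ)
    {t : ℝ} (ht : 0 ≤ t) :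
    ‖∫ σ in Ioi t, cexp (-((a : ℂ) * σ)) • S.app (Real.toNNReal σ) f‖ ≤ ‖f‖ * Real.exp (-(a + μ) * t) / (a + μ) := by
  have hle : ∀ σ ∈ Ioi t, ‖cexp (-((a : ℂ) * σ)) • S.app (Real.toNNReal σ) f‖ ≤ ‖f‖ * Real.exp (-(a + μ) * σ) :=
    fun σ hσ => S.norm_exp_smul_app_le_rate hS a (ht.trans (le_of_lt hσ))
  have hdom : IntegrableOn (fun σ : ℝ => ‖f‖ * Real.exp (-(a + μ) * σ)) (Ioi t) :=
    (integrableOn_exp_mul_Ioi (by linarith) t).const_mul _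
  have hint : IntegrableOn (fun σ : ℝ => cexp (-((a : ℂ) * σ)) • S.app (Real.toNNReal σ) f) (Ioi t) :=
    Integrable.mono' hdom ((S.continuous_integrand a f).aestronglyMeasurable)
      ((ae_restrict_iff' measurableSet_Ioi).2 (Eventually.of_forall hle))
  calc ‖∫ σ in Ioi t, cexp (-((a : ℂ) * σ)) • S.app (Real.toNNReal σ) f‖
      ≤ ∫ σ in Ioi t, ‖cexp (-((a : ℂ) * σ)) • S.app (Real.toNNReal σ) f‖ := norm_integral_le_integral_norm _
    _ ≤ ∫ σ in Ioi t, ‖f‖ * Real.exp (-(a + μ) * σ) := setIntegral_mono_on hint.norm hdom measurableSet_Ioi hle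
    _ = ‖f‖ * Real.exp (-(a + μ) * t) / (a + μ) := by
        rw [MeasureTheory.integral_const_mul, integral_exp_mul_Ioi (by linarith) t]; field_simp

/-- The Duhamel integral of the growing exponential at rate `a`: `∫₀ᵗ e^{as}·S(t−s)f ds = e^{at}·(R(a)f − ∫_{(t,∞)} e^{−aσ}S(σ)f dσ)`.
[cite: EngelNagel2000, Ch. II Thm. 1.10 (1.13)] -/
theorem integral_exp_smul_app_eq_rate {μ a : ℝ} (hS : ∀ t : ℝ≥0, ‖S.app t‖ ≤ Real.exp (-μ * t)) (hμ : 0 < a + μ) {t : ℝ}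
    (ht : 0 ≤ t) :
    ∫ s in (0 : ℝ)..t, cexp ((a : ℂ) * s) • S.app (Real.toNNReal (t - s)) f =
      cexp ((a : ℂ) * t) • (S.laplaceResolventFun a f - ∫ σ in Ioi t, cexp (-((a : ℂ) * σ)) • S.app (Real.toNNReal σ) f) := by
  -- substitution `σ = t − s`
  have hsub := intervalIntegral.integral_comp_sub_left
    (fun σ : ℝ => cexp ((a : ℂ) * ((t - σ : ℝ) : ℂ)) • S.app (Real.toNNReal σ) f) t (a := 0) (b := t)
  simp only [sub_sub_cancel, sub_self, sub_zero] at hsub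
  have h1 : (∫ s in (0 : ℝ)..t, cexp ((a : ℂ) * s) • S.app (Real.toNNReal (t - s)) f) =
      ∫ σ in (0 : ℝ)..t, cexp ((a : ℂ) * ((t - σ : ℝ) : ℂ)) • S.app (Real.toNNReal σ) f := by
    rw [← hsub]
  rw [h1]
  have h2 : ∀ σ : ℝ, cexp ((a : ℂ) * ((t - σ : ℝ) : ℂ)) • S.app (Real.toNNReal σ) f =
      cexp ((a : ℂ) * t) • (cexp (-((a : ℂ) * σ)) • S.app (Real.toNNReal σ) f) := by
    intro σ
    rw [smul_smul, ← Complex.exp_add]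
    congr 1; push_cast; ring_nf
  simp_rw [h2]
  rw [intervalIntegral.integral_smul]
  congr 1
  have hM : ∀ s : ℝ≥0, ‖S.app s‖ ≤ 1 * Real.exp (-μ * s) := fun s => by simpa using hS s
  have hint : IntegrableOn (fun σ : ℝ => cexp (-((a : ℂ) * σ)) • S.app (Real.toNNReal σ) f) (Ioi 0) :=
    S.integrableOn_integrand hM (by simp; linarith) f
  rw [laplaceResolventFun, eq_sub_iff_add_eq]
  exact intervalIntegral.integral_interval_add_Ioi hint (hint.mono_set (Ioi_subset_Ioi ht))

/-- **SCALAR DECAY ⇒ VECTOR DECAY, mode of rate `a`.** Let `‖S(t)‖ ≤ e^{−μt}`, `a + μ > 0`, let `u` be a continuous mild solution of the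
rank-one feedback problem, and suppose its amplitude splits as `‖ℓ(u(s)) − c₁e^{as}‖ ≤ M e^{−β′s}` on `s ≥ 0` with `β′ < μ`. Then for `t ≥ 0`
`‖u(t) − c₁e^{at}·R(a)f‖ ≤ (‖u₀‖ + M‖f‖/(μ − β′) + ‖c₁‖‖f‖/(a + μ))·e^{−β′t}`. [cite: EngelNagel2000, Ch. III Cor. 1.7 / Ch. II (1.13)] -/
theorem norm_mild_sub_mode_le_rate {μ β' M a : ℝ} {c₁ : ℂ} (hS : ∀ t : ℝ≥0, ‖S.app t‖ ≤ Real.exp (-μ * t))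
    (ha : 0 < a + μ) (hu : Continuous u)
    (hmild : ∀ t : ℝ, 0 ≤ t → u t = S.app (Real.toNNReal t) u₀ + ∫ s in (0 : ℝ)..t, S.app (Real.toNNReal (t - s)) (ℓ (u s) • f))
    (hβ'μ : β' < μ)
    (hm : ∀ s : ℝ, 0 ≤ s → ‖ℓ (u s) - c₁ * cexp ((a : ℂ) * s)‖ ≤ M * Real.exp (-β' * s))
    {t : ℝ} (ht : 0 ≤ t) :
    ‖u t - (c₁ * cexp ((a : ℂ) * t)) • S.laplaceResolventFun a f‖ ≤
      (‖u₀‖ + M * ‖f‖ / (μ - β') + ‖c₁‖ * ‖f‖ / (a + μ)) * Real.exp (-β' * t) := by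
  have hM0 : 0 ≤ M := by simpa using (norm_nonneg _).trans (hm 0 le_rfl)
  -- `∫₀ᵗ e^{−β′s}e^{−μ(t−s)} ds ≤ e^{−β′t}/(μ − β′)`
  have hexpint : ∫ s in (0 : ℝ)..t, Real.exp (-β' * s) * Real.exp (-μ * (t - s)) ≤ Real.exp (-β' * t) / (μ - β') := by
    have hc : 0 < μ - β' := sub_pos.2 hβ'μ
    have hpt : ∀ s : ℝ, Real.exp (-β' * s) * Real.exp (-μ * (t - s)) = Real.exp (-μ * t) * Real.exp ((μ - β') * s) := by
      intro s; rw [← Real.exp_add, ← Real.exp_add]; ring_nf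
    simp_rw [hpt]
    rw [intervalIntegral.integral_const_mul]
    have hderiv : ∀ s ∈ uIcc 0 t, HasDerivAt (fun s : ℝ => Real.exp ((μ - β') * s) / (μ - β')) (Real.exp ((μ - β') * s)) s := by
      intro s _
      have h1 : HasDerivAt (fun s : ℝ => (μ - β') * s) (μ - β') s := by simpa using (hasDerivAt_id s).const_mul (μ - β')
      exact (h1.exp.div_const (μ - β')).congr_deriv (by field_simp)
    rw [intervalIntegral.integral_eq_sub_of_hasDerivAt hderiv ((Continuous.continuousOn (by fun_prop)).intervalIntegrable),
      mul_zero, Real.exp_zero]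
    have h3 : Real.exp (-μ * t) * (Real.exp ((μ - β') * t) / (μ - β') - 1 / (μ - β')) =
        (Real.exp (-β' * t) - Real.exp (-μ * t)) / (μ - β') := by
      have he : Real.exp (-μ * t) * Real.exp ((μ - β') * t) = Real.exp (-β' * t) := by
        rw [← Real.exp_add]; ring_nf
      rw [mul_sub, ← mul_div_assoc, he, mul_one_div, div_sub_div_same]
    rw [h3]
    exact div_le_div_of_nonneg_right (by linarith [Real.exp_pos (-μ * t)]) hc.le
  -- continuity / integrability of the pieces
  have hSf : Continuous fun s : ℝ => S.app (Real.toNNReal (t - s)) f :=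
    (S.continuous_app f).comp (continuous_real_toNNReal.comp (continuous_const.sub continuous_id))
  have hm_c : Continuous fun s : ℝ => ℓ (u s) := ℓ.continuous.comp hu
  have hec : Continuous fun s : ℝ => c₁ * cexp ((a : ℂ) * s) := by fun_prop
  have hi1 : IntervalIntegrable (fun s : ℝ => (ℓ (u s) - c₁ * cexp ((a : ℂ) * s)) • S.app (Real.toNNReal (t - s)) f) volume 0 t :=
    ((hm_c.sub hec).smul hSf).intervalIntegrable 0 t
  have hi2 : IntervalIntegrable (fun s : ℝ => (c₁ * cexp ((a : ℂ) * s)) • S.app (Real.toNNReal (t - s)) f) volume 0 t :=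
    (hec.smul hSf).intervalIntegrable 0 t
  -- the decomposition of the Duhamel term
  have hsplit : (∫ s in (0 : ℝ)..t, ℓ (u s) • S.app (Real.toNNReal (t - s)) f) =
      (∫ s in (0 : ℝ)..t, (ℓ (u s) - c₁ * cexp ((a : ℂ) * s)) • S.app (Real.toNNReal (t - s)) f) +
        c₁ • ∫ s in (0 : ℝ)..t, cexp ((a : ℂ) * s) • S.app (Real.toNNReal (t - s)) f := by
    rw [← intervalIntegral.integral_smul, ← intervalIntegral.integral_add hi1 (by
      simpa [smul_smul] using hi2)]
    refine intervalIntegral.integral_congr fun s _ => ?_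
    simp only [smul_smul, ← add_smul, sub_add_cancel]
  set tail : X := ∫ σ in Ioi t, cexp (-((a : ℂ) * σ)) • S.app (Real.toNNReal σ) f with htail
  have hkey : u t - (c₁ * cexp ((a : ℂ) * t)) • S.laplaceResolventFun a f =
      S.app (Real.toNNReal t) u₀ +
        (∫ s in (0 : ℝ)..t, (ℓ (u s) - c₁ * cexp ((a : ℂ) * s)) • S.app (Real.toNNReal (t - s)) f) -
        (c₁ * cexp ((a : ℂ) * t)) • tail := by
    rw [S.mild_eq_smul hmild ht, hsplit, S.integral_exp_smul_app_eq_rate hS ha ht, smul_sub, smul_sub, smul_smul, smul_smul]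
    abel
  rw [hkey]
  -- three bounds
  have hb1 : ‖S.app (Real.toNNReal t) u₀‖ ≤ ‖u₀‖ * Real.exp (-β' * t) := by
    refine (S.norm_app_toNNReal_le hS u₀ ht).trans ?_
    rw [mul_comm]
    exact mul_le_mul_of_nonneg_left (Real.exp_le_exp.2 (by nlinarith)) (norm_nonneg _)
  have hb2 : ‖∫ s in (0 : ℝ)..t, (ℓ (u s) - c₁ * cexp ((a : ℂ) * s)) • S.app (Real.toNNReal (t - s)) f‖ ≤
      M * ‖f‖ / (μ - β') * Real.exp (-β' * t) := by
    have hle : ∀ s ∈ Set.Ioc (0 : ℝ) t, ‖(ℓ (u s) - c₁ * cexp ((a : ℂ) * s)) • S.app (Real.toNNReal (t - s)) f‖ ≤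
        M * ‖f‖ * (Real.exp (-β' * s) * Real.exp (-μ * (t - s))) := by
      intro s hs
      rw [norm_smul]
      calc ‖ℓ (u s) - c₁ * cexp ((a : ℂ) * s)‖ * ‖S.app (Real.toNNReal (t - s)) f‖
          ≤ (M * Real.exp (-β' * s)) * (Real.exp (-μ * (t - s)) * ‖f‖) :=
            mul_le_mul (hm s hs.1.le) (S.norm_app_toNNReal_le hS f (by linarith [hs.2])) (norm_nonneg _) (by positivity)
        _ = M * ‖f‖ * (Real.exp (-β' * s) * Real.exp (-μ * (t - s))) := by ring
    refine (intervalIntegral.norm_integral_le_of_norm_le ht (Eventually.of_forall hle)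
      ((Continuous.continuousOn (by fun_prop)).intervalIntegrable)).trans ?_
    rw [intervalIntegral.integral_const_mul]
    calc M * ‖f‖ * ∫ s in (0 : ℝ)..t, Real.exp (-β' * s) * Real.exp (-μ * (t - s))
        ≤ M * ‖f‖ * (Real.exp (-β' * t) / (μ - β')) := mul_le_mul_of_nonneg_left hexpint (by positivity)
      _ = M * ‖f‖ / (μ - β') * Real.exp (-β' * t) := by ring
  have hb3 : ‖(c₁ * cexp ((a : ℂ) * t)) • tail‖ ≤ ‖c₁‖ * ‖f‖ / (a + μ) * Real.exp (-β' * t) := by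
    rw [norm_smul, norm_mul, Complex.norm_exp]
    have hre : ((a : ℂ) * t).re = a * t := by simp
    rw [hre]
    have htl := S.norm_integral_Ioi_resolvent_le_rate (f := f) hS ha ht
    calc ‖c₁‖ * Real.exp (a * t) * ‖tail‖ ≤ ‖c₁‖ * Real.exp (a * t) * (‖f‖ * Real.exp (-(a + μ) * t) / (a + μ)) :=
          mul_le_mul_of_nonneg_left htl (by positivity)
      _ = ‖c₁‖ * ‖f‖ / (a + μ) * (Real.exp (a * t) * Real.exp (-(a + μ) * t)) := by ring
      _ = ‖c₁‖ * ‖f‖ / (a + μ) * Real.exp (-μ * t) := by rw [← Real.exp_add]; ring_nf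
      _ ≤ ‖c₁‖ * ‖f‖ / (a + μ) * Real.exp (-β' * t) :=
          mul_le_mul_of_nonneg_left (Real.exp_le_exp.2 (by nlinarith)) (by positivity)
  calc ‖S.app (Real.toNNReal t) u₀ +
        (∫ s in (0 : ℝ)..t, (ℓ (u s) - c₁ * cexp ((a : ℂ) * s)) • S.app (Real.toNNReal (t - s)) f) -
        (c₁ * cexp ((a : ℂ) * t)) • tail‖
      ≤ ‖S.app (Real.toNNReal t) u₀‖ +
          ‖∫ s in (0 : ℝ)..t, (ℓ (u s) - c₁ * cexp ((a : ℂ) * s)) • S.app (Real.toNNReal (t - s)) f‖ +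
        ‖(c₁ * cexp ((a : ℂ) * t)) • tail‖ := by
          refine (norm_sub_le _ _).trans (add_le_add (norm_add_le _ _) le_rfl)
    _ ≤ _ := by rw [add_mul, add_mul]; exact add_le_add (add_le_add hb1 hb2) hb3

end DecayRate

end C0Semigroup

end Literature.Analysis.UnboundedOperators
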